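import Literature.MathematicalPhysics.QuantumFieldTheory.QCDTimeReflectionProofs
import HarnessLib

/-!
# The antilinear `γ₅`-conjugation `K` of Wilson lattice QCD (quark Grassmann algebras and observables)

`γ₅`-hermiticity of the Wilson–Dirac operator, `D(U)† = γ₅ D(U) γ₅` for every gauge field `U`
(Montvay–Münster (4.35), (5.15); tree `wilsonDirac_gammaFive_hermitian_holds`), is usually quoted for its
two consequences "the fermion determinant is real" and "hadron correlators are real / come in complex
conjugate pairs".  Both are shadows of ONE symmetry of the Grassmann functional integral at FIXED gauge
field, which this file defines: the **antilinear, order-PRESERVING** ring endomorphism `K` of the quark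
Grassmann algebra given on generators by

  `K ψ_{f,x,a,α} = −∑_σ ψ̄_{f,x,a,σ} (γ₅)_{σα}`,  `K ψ̄_{f,x,a,α} = ∑_σ (γ₅)_{ασ} ψ_{f,x,a,σ}`,
  coefficients complex conjugated, links untouched

(`K = Λ(K₀) ∘ conj`, `K₀ = torusKLin` / `fermiKLin`).  It exchanges quarks and antiquarks flavour by
flavour (so it reverses every vector-flavour charge), fixes the site, the colour and the gauge field, and
`K(ψ̄ D(U) ψ) = ψ̄ (γ₅ D(U)† γ₅) ψ = ψ̄ D(U) ψ` — one anticommutation `ψψ̄ = −ψ̄ψ` absorbs the sign of `K₀`.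
In Minkowski language it is the product of charge conjugation with the antiunitary `CPT`-type
conjugation; on the lattice it is the cheapest exact symmetry exchanging the flavour sectors `q ↦ −q`
(charge conjugation proper, `ψ ↦ C ψ̄ᵀ`, `U ↦ U*`, Montvay–Münster (4.54)–(4.58)/(5.107), also moves the
gauge field).

## Content (definitions and the functorial API; the computational theorems are in the companion
theorem files `QCDGammaFiveConjugationTorus`, `QCDGammaFiveConjugationObservables`)

* torus level (`FermiAlg Nf L`): `torusKLin`, `torusK` (a `conj`-semilinear map), `torusKRingHom`
  (the same map as a ring homomorphism: `K(ab) = K(a)K(b)`), `torusK_ι`, `torusK_algebraMap`;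
  `kSpinIdx`, `kMatrix A` (the matrix with `K(ψ̄Aψ) = ψ̄ A^K ψ`:
  `(A^K)_{pq} = ∑_{αβ} (γ₅)_{σ_p β} conj A_{q_α p_β} (γ₅)_{α σ_q}`, i.e. `γ₅ A† γ₅` blockwise);
  `kBerezinConst` (the fermionic Jacobian `det K₀` in `∫dψ̄dψ ∘ K = det K₀ · conj ∘ ∫dψ̄dψ`).
* box level (`BoxFermiAlg Nf R`): `fermiKLin`, `fermiK`, `fermiKRingHom`, the gauge intertwining
  `fermiGaugeAct g (K y) = K (fermiGaugeAct g y)` (unitarity of `SU(3)`: `(g⁻¹)_{ba} = conj g_{ab}`), and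
  the conjugate observable `QCDLatticeObservable.kConj A` (`(A^K)(U) = K(A(U))`, same link support; a
  gauge-invariant local observable with bounded measurable coefficients — all proved here).

## Sources

I. Montvay, G. Münster, *Quantum Fields on a Lattice* (CUP 1994): §4.2 (4.35) (`γ₅`-hermiticity),
§5.1.2 (5.15)–(5.16) (reality of the quark determinant), §4.1 (Grassmann integration), §5.1.1 (5.6)
(flavour symmetry); M. Lüscher, Commun. Math. Phys. 54 (1977) 283 (the quark Grassmann algebra of Wilson's
lattice QCD).  The packaging of `γ₅`-hermiticity as an antilinear Grassmann ring map is folklore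
(it is the map behind "`C(t)* = ±C(t)` for meson correlators").

## Design choices / not here

* `K` is ORDER-PRESERVING (`Λ(K₀) ∘ conj`, no `reverse`), unlike the Osterwalder–Seiler reflection
  `Θ = rev ∘ Λ(T) ∘ conj` of `QCDTimeReflection`; it does not move sites or links.
* The sign sits on the `ψ ↦ ψ̄` half of `K₀`; with it `K` FIXES the quark action (no sign), and
  `K² = (−1)^{degree}` (the Grassmann parity automorphism).
* The identities `K e^{−ψ̄D(U)ψ} = e^{−ψ̄D(U)ψ}` (both torus functionals), `⟨K∘X⟩ = conj ⟨X⟩`,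
  `(A^K).onTorus = K ∘ A.onTorus`, the flavour-charge flip and `Θ ∘ K = K ∘ Θ` are theorems of the
  companion files, not of this one.
-/

open MeasureTheory
open scoped Matrix ComplexConjugate
open Literature.Probability Literature.Probability.LatticeModels Literature.MathematicalPhysics.QuantumLattice

noncomputable section

namespace Literature.MathematicalPhysics.QuantumFieldTheory

/-! ### `K` on the torus quark Grassmann algebra -/

section TorusK

variable {Nf L : ℕ} [NeZero L]

/-- **The `γ₅`-conjugation on torus quark generators**: the linear map of generator-coefficient
vectors inducing `ψ_{f,x,a,α} ↦ −∑_σ ψ̄_{f,x,a,σ} (γ₅)_{σα}` and `ψ̄_{f,x,a,α} ↦ ∑_σ (γ₅)_{ασ} ψ_{f,x,a,σ}`.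
In coordinates: `(K₀ c)_{ψ̄,(f,x,a,σ)} = −∑_α (γ₅)_{σα} c_{ψ,(f,x,a,α)}`,
`(K₀ c)_{ψ,(f,x,a,σ)} = ∑_α (γ₅)_{ασ} c_{ψ̄,(f,x,a,α)}`. [folklore] -/
def torusKLin :
    ((FermiIdx Nf L ⊕ₗ FermiIdx Nf L) → ℂ) →ₗ[ℂ] ((FermiIdx Nf L ⊕ₗ FermiIdx Nf L) → ℂ) :=
  LinearMap.pi fun w =>
    match ofLex w with
    | Sum.inl i =>
        let v := quarkEquiv.symm i
        ∑ α : Fin 4, (-gammaFive v.2.2.2 α) •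
          LinearMap.proj (toLex (Sum.inr (quarkEquiv (v.1, (v.2.1, v.2.2.1, α)))))
    | Sum.inr i =>
        let v := quarkEquiv.symm i
        ∑ α : Fin 4, (gammaFive α v.2.2.2) •
          LinearMap.proj (toLex (Sum.inl (quarkEquiv (v.1, (v.2.1, v.2.2.1, α)))))

/-- The `ψ̄`-coordinates of `K₀ c`: `(K₀ c)_{ψ̄,(f,x,a,σ)} = −∑_α (γ₅)_{σα} c_{ψ,(f,x,a,α)}`. [folklore] -/
theorem torusKLin_apply_inl (c : (FermiIdx Nf L ⊕ₗ FermiIdx Nf L) → ℂ) (v : QuarkVar Nf L) :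
    torusKLin c (toLex (Sum.inl (quarkEquiv v))) =
      ∑ α : Fin 4, -gammaFive v.2.2.2 α * c (toLex (Sum.inr (quarkEquiv (v.1, (v.2.1, v.2.2.1, α))))) := by
  simp only [torusKLin, LinearMap.pi_apply, ofLex_toLex, Equiv.symm_apply_apply,
    LinearMap.coe_sum, Finset.sum_apply, LinearMap.smul_apply, LinearMap.proj_apply, smul_eq_mul]

/-- The `ψ`-coordinates of `K₀ c`: `(K₀ c)_{ψ,(f,x,a,σ)} = ∑_α (γ₅)_{ασ} c_{ψ̄,(f,x,a,α)}`. [folklore] -/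
theorem torusKLin_apply_inr (c : (FermiIdx Nf L ⊕ₗ FermiIdx Nf L) → ℂ) (v : QuarkVar Nf L) :
    torusKLin c (toLex (Sum.inr (quarkEquiv v))) =
      ∑ α : Fin 4, gammaFive α v.2.2.2 * c (toLex (Sum.inl (quarkEquiv (v.1, (v.2.1, v.2.2.1, α))))) := by
  simp only [torusKLin, LinearMap.pi_apply, ofLex_toLex, Equiv.symm_apply_apply,
    LinearMap.coe_sum, Finset.sum_apply, LinearMap.smul_apply, LinearMap.proj_apply, smul_eq_mul]

/-- **The `γ₅`-conjugation `K` on the torus quark Grassmann algebra**: `K = Λ(K₀) ∘ conj` — conjugate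
the coefficients, substitute the generators by `torusKLin`; NO order reversal.  Bundled as a
`conj`-semilinear map (multiplicativity: `torusK_mul`, `torusKRingHom`). [folklore] -/
def torusK : FermiAlg Nf L →ₗ⋆[ℂ] FermiAlg Nf L :=
  (ExteriorAlgebra.map (torusKLin (Nf := Nf) (L := L))).toLinearMap.comp grassmannConjₛₗ

/-- `K a = Λ(K₀) (conj a)`. [folklore] -/
theorem torusK_apply (a : FermiAlg Nf L) :
    torusK a = ExteriorAlgebra.map (torusKLin (Nf := Nf) (L := L)) (grassmannConj a) := rfl

/-- `K` is multiplicative and ORDER-PRESERVING: `K(ab) = K(a) K(b)`. [folklore] -/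
theorem torusK_mul (a b : FermiAlg Nf L) : torusK (a * b) = torusK a * torusK b := by
  simp only [torusK_apply, map_mul]

/-- `K 1 = 1`. [folklore] -/
@[simp] theorem torusK_one : torusK (1 : FermiAlg Nf L) = 1 := by
  simp only [torusK_apply, map_one]

/-- `K` on scalars is complex conjugation. [folklore] -/
@[simp] theorem torusK_algebraMap (c : ℂ) :
    torusK (algebraMap ℂ (FermiAlg Nf L) c) = algebraMap ℂ (FermiAlg Nf L) (starRingEnd ℂ c) := by
  simp only [torusK_apply, grassmannConj_algebraMap, AlgHom.commutes]

/-- `K` on a degree-one element: `K θ(v) = θ(K₀ v̄)`. [folklore] -/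
theorem torusK_ι (v : (FermiIdx Nf L ⊕ₗ FermiIdx Nf L) → ℂ) :
    torusK (ExteriorAlgebra.ι ℂ v) = ExteriorAlgebra.ι ℂ (torusKLin (Nf := Nf) (L := L) (star v)) := by
  simp only [torusK_apply, grassmannConj_ι, ExteriorAlgebra.map_apply_ι]

/-- `K` as a ring endomorphism of the torus quark Grassmann algebra (it is antilinear, so not an
algebra map). [folklore] -/
def torusKRingHom : FermiAlg Nf L →+* FermiAlg Nf L :=
  (ExteriorAlgebra.map (torusKLin (Nf := Nf) (L := L))).toRingHom.comp grassmannConj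

/-- The ring endomorphism is the semilinear map. [folklore] -/
@[simp] theorem torusKRingHom_apply (a : FermiAlg Nf L) : torusKRingHom a = torusK a := rfl

/-- `K` of a power. [folklore] -/
theorem torusK_pow (a : FermiAlg Nf L) (n : ℕ) : torusK (a ^ n) = torusK a ^ n := by
  rw [← torusKRingHom_apply, map_pow, torusKRingHom_apply]

/-- The index of the quark variable behind `p` with its spin replaced by `β` (same flavour, site and
colour). [folklore] -/
def kSpinIdx (p : FermiIdx Nf L) (β : Fin 4) : FermiIdx Nf L :=
  quarkEquiv ((quarkEquiv.symm p).1, ((quarkEquiv.symm p).2.1, (quarkEquiv.symm p).2.2.1, β))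

/-- `kSpinIdx` on an enumerated quark variable. [folklore] -/
@[simp] theorem kSpinIdx_quarkEquiv (v : QuarkVar Nf L) (β : Fin 4) :
    kSpinIdx (quarkEquiv v) β = quarkEquiv (v.1, (v.2.1, v.2.2.1, β)) := by
  simp [kSpinIdx]

/-- **The `K`-conjugate of a fermion matrix**, the matrix with `K(ψ̄ A ψ) = ψ̄ A^K ψ`:
`(A^K)_{pq} = ∑_{αβ} (γ₅)_{σ_p β} conj A_{q_α, p_β} (γ₅)_{α σ_q}` — blockwise `γ₅ A† γ₅` (conjugate the
entries, swap the two indices, sandwich the spin blocks with `γ₅`).  `γ₅`-hermiticity of a Dirac matrix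
`D` reads `D^K = D`. [cite: MontvayMunster1994, §4.2 (4.35)] -/
def kMatrix (A : Matrix (FermiIdx Nf L) (FermiIdx Nf L) ℂ) : Matrix (FermiIdx Nf L) (FermiIdx Nf L) ℂ :=
  fun p q => ∑ α : Fin 4, ∑ β : Fin 4, gammaFive (quarkEquiv.symm p).2.2.2 β *
    star (A (kSpinIdx q α) (kSpinIdx p β)) * gammaFive α (quarkEquiv.symm q).2.2.2

/-- `kMatrix` is conjugate-linear: it commutes with negation. [folklore] -/
theorem kMatrix_neg (A : Matrix (FermiIdx Nf L) (FermiIdx Nf L) ℂ) : kMatrix (-A) = -kMatrix A := by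
  ext p q
  simp only [kMatrix, Matrix.neg_apply, star_neg, mul_neg, neg_mul, Finset.sum_neg_distrib]

variable (Nf L) in
/-- The constant relating `∫dψ̄dψ ∘ K` to `conj ∘ ∫dψ̄dψ`: the fermionic Jacobian `det K₀` of the
generator substitution (no reversal sign, `K` preserves the order). [folklore] -/
def kBerezinConst : ℂ := LinearMap.det (torusKLin (Nf := Nf) (L := L))

/-- **The Berezin integral of a `K`-conjugated element**: `∫dψ̄dψ (K a) = det K₀ · conj (∫dψ̄dψ a)`
(`berezin_map`, `berezin_grassmannConj`). [folklore] -/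
theorem fermiIntegral_torusK (a : FermiAlg Nf L) :
    fermiIntegral (torusK a) = kBerezinConst Nf L * starRingEnd ℂ (fermiIntegral a) := by
  rw [fermiIntegral, torusK_apply, GrassmannAlgebra.berezin_map, berezin_grassmannConj, kBerezinConst]

end TorusK

/-! ### `K` on the boxed quark Grassmann algebra and on observables -/

section BoxK

local notation "𝔾" => Matrix.specialUnitaryGroup (Fin 3) ℂ

variable {Nf R : ℕ}

/-- **The `γ₅`-conjugation on boxed quark generators** (box twin of `torusKLin`):
`(K₀ c)_{ψ̄,(f,x,a,σ)} = −∑_α (γ₅)_{σα} c_{ψ,(f,x,a,α)}`, `(K₀ c)_{ψ,(f,x,a,σ)} = ∑_α (γ₅)_{ασ} c_{ψ̄,(f,x,a,α)}`. [folklore] -/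
def fermiKLin :
    ((BoxFermiIdx Nf R ⊕ₗ BoxFermiIdx Nf R) → ℂ) →ₗ[ℂ] ((BoxFermiIdx Nf R ⊕ₗ BoxFermiIdx Nf R) → ℂ) :=
  LinearMap.pi fun w =>
    match ofLex w with
    | Sum.inl i =>
        let v := boxQuarkEquiv.symm i
        ∑ α : Fin 4, (-gammaFive v.2.2.2 α) •
          LinearMap.proj (toLex (Sum.inr (boxQuarkEquiv (v.1, (v.2.1, v.2.2.1, α)))))
    | Sum.inr i =>
        let v := boxQuarkEquiv.symm i
        ∑ α : Fin 4, (gammaFive α v.2.2.2) •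
          LinearMap.proj (toLex (Sum.inl (boxQuarkEquiv (v.1, (v.2.1, v.2.2.1, α)))))

/-- The `ψ̄`-coordinates of `K₀ c` (box). [folklore] -/
theorem fermiKLin_apply_inl (c : (BoxFermiIdx Nf R ⊕ₗ BoxFermiIdx Nf R) → ℂ) (v : BoxQuarkVar Nf R) :
    fermiKLin c (toLex (Sum.inl (boxQuarkEquiv v))) =
      ∑ α : Fin 4, -gammaFive v.2.2.2 α *
        c (toLex (Sum.inr (boxQuarkEquiv (v.1, (v.2.1, v.2.2.1, α))))) := by
  simp only [fermiKLin, LinearMap.pi_apply, ofLex_toLex, Equiv.symm_apply_apply,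
    LinearMap.coe_sum, Finset.sum_apply, LinearMap.smul_apply, LinearMap.proj_apply, smul_eq_mul]

/-- The `ψ`-coordinates of `K₀ c` (box). [folklore] -/
theorem fermiKLin_apply_inr (c : (BoxFermiIdx Nf R ⊕ₗ BoxFermiIdx Nf R) → ℂ) (v : BoxQuarkVar Nf R) :
    fermiKLin c (toLex (Sum.inr (boxQuarkEquiv v))) =
      ∑ α : Fin 4, gammaFive α v.2.2.2 *
        c (toLex (Sum.inl (boxQuarkEquiv (v.1, (v.2.1, v.2.2.1, α))))) := by
  simp only [fermiKLin, LinearMap.pi_apply, ofLex_toLex, Equiv.symm_apply_apply,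
    LinearMap.coe_sum, Finset.sum_apply, LinearMap.smul_apply, LinearMap.proj_apply, smul_eq_mul]

/-- **The `γ₅`-conjugation `K` on the boxed quark Grassmann algebra**: `K = Λ(K₀) ∘ conj` (box twin of
`torusK`). [folklore] -/
def fermiK : BoxFermiAlg Nf R →ₗ⋆[ℂ] BoxFermiAlg Nf R :=
  (ExteriorAlgebra.map (fermiKLin (Nf := Nf) (R := R))).toLinearMap.comp grassmannConjₛₗ

/-- `K a = Λ(K₀) (conj a)` (box). [folklore] -/
theorem fermiK_apply (a : BoxFermiAlg Nf R) :
    fermiK a = ExteriorAlgebra.map (fermiKLin (Nf := Nf) (R := R)) (grassmannConj a) := rfl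

/-- `K(ab) = K(a) K(b)` (box). [folklore] -/
theorem fermiK_mul (a b : BoxFermiAlg Nf R) : fermiK (a * b) = fermiK a * fermiK b := by
  simp only [fermiK_apply, map_mul]

/-- `K 1 = 1` (box). [folklore] -/
@[simp] theorem fermiK_one : fermiK (1 : BoxFermiAlg Nf R) = 1 := by
  simp only [fermiK_apply, map_one]

/-- `K` on scalars is complex conjugation (box). [folklore] -/
@[simp] theorem fermiK_algebraMap (c : ℂ) :
    fermiK (algebraMap ℂ (BoxFermiAlg Nf R) c) = algebraMap ℂ (BoxFermiAlg Nf R) (starRingEnd ℂ c) := by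
  simp only [fermiK_apply, grassmannConj_algebraMap, AlgHom.commutes]

/-- `K θ(v) = θ(K₀ v̄)` (box). [folklore] -/
theorem fermiK_ι (v : (BoxFermiIdx Nf R ⊕ₗ BoxFermiIdx Nf R) → ℂ) :
    fermiK (ExteriorAlgebra.ι ℂ v) = ExteriorAlgebra.ι ℂ (fermiKLin (Nf := Nf) (R := R) (star v)) := by
  simp only [fermiK_apply, grassmannConj_ι, ExteriorAlgebra.map_apply_ι]

/-- `K` as a ring endomorphism of the boxed quark Grassmann algebra. [folklore] -/
def fermiKRingHom : BoxFermiAlg Nf R →+* BoxFermiAlg Nf R :=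
  (ExteriorAlgebra.map (fermiKLin (Nf := Nf) (R := R))).toRingHom.comp grassmannConj

/-- The ring endomorphism is the semilinear map (box). [folklore] -/
@[simp] theorem fermiKRingHom_apply (a : BoxFermiAlg Nf R) : fermiKRingHom a = fermiK a := rfl

/-- **`K` intertwines the gauge action, at the level of generators**: with `G_g` the coefficient map
of the gauge transformation `g` (`fermiGaugeLin`), `G_g ∘ K₀ = K₀ ∘ conj(G_g)` — because
`(g⁻¹)_{ba} = conj g_{ab}` for `g ∈ SU(3)` (`K₀` keeps the site, so the SAME `g` appears on both sides,
unlike the reflection `Θ`). [folklore] -/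
theorem fermiGaugeLin_comp_fermiKLin (g : LatticeModels.Site 4 → 𝔾) :
    fermiGaugeLin (Nf := Nf) (R := R) g ∘ₗ fermiKLin =
      fermiKLin ∘ₗ conjLin (fermiGaugeLin (Nf := Nf) (R := R) g) := by
  refine LinearMap.ext fun c => funext fun w => ?_
  obtain ⟨x, rfl⟩ : ∃ x, toLex x = w := ⟨ofLex w, rfl⟩
  rcases x with i | i
  · simp only [LinearMap.comp_apply, fermiGaugeLin, fermiKLin, conjLin_apply, LinearMap.pi_apply,
      ofLex_toLex, LinearMap.coe_sum, Finset.sum_apply, LinearMap.smul_apply, LinearMap.proj_apply,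
      Equiv.symm_apply_apply, Pi.star_apply, star_sum, star_mul', star_star, smul_eq_mul,
      Finset.mul_sum, specialUnitary_inv_apply, neg_mul, mul_neg, Finset.sum_neg_distrib]
    rw [Finset.sum_comm]
    refine congrArg Neg.neg (Finset.sum_congr rfl fun a _ => Finset.sum_congr rfl fun α _ => ?_)
    ring
  · simp only [LinearMap.comp_apply, fermiGaugeLin, fermiKLin, conjLin_apply, LinearMap.pi_apply,
      ofLex_toLex, LinearMap.coe_sum, Finset.sum_apply, LinearMap.smul_apply, LinearMap.proj_apply,
      Equiv.symm_apply_apply, Pi.star_apply, star_sum, star_mul', star_star, smul_eq_mul,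
      Finset.mul_sum, specialUnitary_inv_apply]
    rw [Finset.sum_comm]
    refine Finset.sum_congr rfl fun a _ => Finset.sum_congr rfl fun α _ => ?_
    ring

/-- **`K` intertwines the gauge action**: `g · K(y) = K(g · y)` on the whole boxed Grassmann algebra
(so `K` maps gauge-invariant observables to gauge-invariant observables). [folklore] -/
theorem fermiGaugeAct_fermiK (g : LatticeModels.Site 4 → 𝔾) (y : BoxFermiAlg Nf R) :
    fermiGaugeAct g (fermiK y) = fermiK (fermiGaugeAct g y) := by
  simp only [fermiK_apply, fermiGaugeAct]
  rw [← AlgHom.comp_apply, ExteriorAlgebra.map_comp_map, grassmannConj_map,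
    ← AlgHom.comp_apply (ExteriorAlgebra.map fermiKLin), ExteriorAlgebra.map_comp_map,
    fermiGaugeLin_comp_fermiKLin]

namespace QCDLatticeObservable

/-- **The `γ₅`-conjugate `A^K` of a gauge-invariant local lattice QCD observable**:
`(A^K)(U) = K(A(U))` — the gauge field is untouched, the element of the quark Grassmann algebra is
transformed by the antilinear, order-preserving `fermiK`.  It is again a gauge-invariant local
observable with the same quark box and the same link support; it carries the OPPOSITE vector-flavour
charges, and its correlators in either torus functional are the complex conjugates of those of `A`
(companion theorem files). [folklore] -/
def kConj (A : QCDLatticeObservable Nf R) : QCDLatticeObservable Nf R where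
  F U := fermiK (A.F U)
  supp := A.supp
  isCylinder U V hUV := by
    change fermiK (A.F U) = fermiK (A.F V)
    rw [A.isCylinder hUV]
  gaugeInvariant g U := by
    rw [fermiGaugeAct_fermiK, A.gaugeInvariant]
  bounded y := by
    classical
    choose ys hys using fun s =>
      exists_berezin_mul_eq_coord ℂ (ι := BoxFermiIdx Nf R ⊕ₗ BoxFermiIdx Nf R) s
    choose C hC using fun s => A.bounded (ys s)
    refine ⟨∑ s, C s * ‖GrassmannAlgebra.berezin ℂ (BoxFermiIdx Nf R ⊕ₗ BoxFermiIdx Nf R)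
      (fermiK (GrassmannAlgebra.grassmannBasis ℂ _ s) * y)‖, fun U => ?_⟩
    rw [semilinear_apply_eq_sum_coord fermiK (A.F U), Finset.sum_mul, map_sum]
    refine (norm_sum_le _ _).trans (Finset.sum_le_sum fun s _ => ?_)
    rw [smul_mul_assoc, map_smul, smul_eq_mul, norm_mul, Complex.norm_conj, ← hys s]
    exact mul_le_mul_of_nonneg_right (hC s _) (norm_nonneg _)
  measurable y := by
    classical
    choose ys hys using fun s =>
      exists_berezin_mul_eq_coord ℂ (ι := BoxFermiIdx Nf R ⊕ₗ BoxFermiIdx Nf R) s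
    have hrw : (fun U => GrassmannAlgebra.berezin ℂ (BoxFermiIdx Nf R ⊕ₗ BoxFermiIdx Nf R)
        (fermiK (A.F U) * y)) = fun U => ∑ s,
          starRingEnd ℂ (GrassmannAlgebra.berezin ℂ _ (A.F U * ys s)) *
            GrassmannAlgebra.berezin ℂ _ (fermiK (GrassmannAlgebra.grassmannBasis ℂ _ s) * y) := by
      funext U
      rw [semilinear_apply_eq_sum_coord fermiK (A.F U), Finset.sum_mul, map_sum]
      simp only [smul_mul_assoc, map_smul, smul_eq_mul, hys]
    rw [hrw]
    refine Finset.measurable_sum _ fun s _ => ?_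
    exact (Complex.continuous_conj.measurable.comp (A.measurable (ys s))).mul_const _

/-- The conjugate observable, unfolded. [folklore] -/
@[simp] theorem kConj_F (A : QCDLatticeObservable Nf R) (U : LGConfig 4 𝔾) :
    A.kConj.F U = fermiK (A.F U) := rfl

/-- The conjugate observable has the same link support. [folklore] -/
@[simp] theorem kConj_supp (A : QCDLatticeObservable Nf R) : A.kConj.supp = A.supp := rfl

end QCDLatticeObservable

end BoxK

end Literature.MathematicalPhysics.QuantumFieldTheory

end
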